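import Literature.NumberTheory.NumberFields.HenselDifferentBound
import HarnessLib

/-!
# Tame primes: `ord_β(𝔇) = e_β - 1` when the residue characteristic exceeds `e_β f_β`, and
# unramifiedness of reduced fibres in large characteristic (Javanpeykar 2014, proof of Thm. 4.3.2)

Topic `NumberTheory/NumberFields`; theorem-only sequel of `HenselDifferentBound.lean`
(Javanpeykar 2014, Prop. 4.1.3: `r_β ≤ e_β - 1 + e_β · ord_A(p^m)`). In the proof of
[Javanpeykar2014, Thm. 4.3.2] (a model `π : 𝒴 → ℙ¹_{O_L}` of a cover of degree `deg π` whose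
branch locus has vertical part only in characteristics `≤ deg π`) the algebra is:

> "Let `𝔭 ⊂ O_L` be a maximal ideal of residue characteristic strictly bigger than `deg π`, and note
> that the ramification of `π : 𝒴 → ℙ¹_{O_L}` over (each prime divisor of `ℙ¹_{O_L}` lying over) `𝔭`
> is tame. Since the fibres of `𝒴 → Spec O_L` are reduced, we see that the finite morphism `π` is
> unramified over `𝔭`. In fact, … the valuation of the different ideal `𝒟_{𝒪_D/𝒪_{π(D)}}` on `𝒪_D`
> of an irreducible component `D` of `𝒴_𝔭` lying over `π(D)` is precisely the multiplicity of `D` in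
> `𝒴_𝔭`" [minus one].

Here `A = 𝒪_{π(D)}` is a discrete valuation ring (the local ring of the regular surface `ℙ¹_{O_L}`
at the generic point of a fibre component), `B ⊇ A` the finite extension cut out by `𝒴` (a
Dedekind domain, semilocal), `β` the prime of `D`, `e_β` = the multiplicity of `D` in `𝒴_𝔭`
(as `ℙ¹_{O_L} → Spec O_L` is smooth), `f_β = [κ(D) : κ(π(D))]`, and `e_β f_β ≤ deg π < p`. We prove,
for `A` a discrete valuation ring with residue characteristic `p` (`p ∈ 𝔪_A` prime), `B` Dedekind,
finite and torsion-free over `A`, `L = Frac B` separable over `K = Frac A`, `β` maximal with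
`𝔪 B = β^e · I`, `β + I = B`, `f = dim_κ (B ⧸ β)`:

* `not_pow_dvd_differentIdeal_of_mul_finrank_lt` — **tame bound**: if `e f < p` then
  `β ^ e ∤ 𝔇_{B/A}`, i.e. `r_β ≤ e_β - 1` (the case `m = 0`, `k = 1` of Prop. 4.1.3: no residual
  separability hypothesis is needed, `p > e f` forces it);
* `pow_sub_one_dvd_differentIdeal_of_map_eq` — Mathlib's universal lower bound `β ^ (e-1) ∣ 𝔇_{B/A}`
  in this setting, so that together **`r_β = e_β - 1`** ("the valuation of the different ideal … is
  precisely the multiplicity … [minus one]");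
* `not_dvd_differentIdeal_of_finrank_lt` — **reduced fibre ⇒ unramified**: if `e = 1`
  (`𝔪 B = β · I`, `β + I = B`) and `f < p`, then `β ∤ 𝔇_{B/A}`, equivalently
  (`isUnramifiedAt_of_finrank_lt`, Mathlib's `not_dvd_differentIdeal_iff`) `B` is unramified at `β`.

Everything is proved; no definition, no named fact.

## References

* A. Javanpeykar, *Polynomial bounds for Arakelov invariants of Belyi curves*, Algebra & Number
  Theory 8 (2014) 89–140, arXiv:1403.6404: Prop. 4.1.3, proof of Thm. 4.3.2. [Javanpeykar2014]
* J.-P. Serre, *Corps locaux*, Ch. III §6, Prop. 13 (tame ramification and the different).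
-/

namespace Literature.NumberTheory.NumberFields

open IsLocalRing

section Tame

variable (A K L B : Type*) [CommRing A] [IsDomain A] [IsDiscreteValuationRing A] [Field K]
  [Algebra A K] [IsFractionRing A K] [CommRing B] [IsDedekindDomain B] [Field L]
  [Algebra B L] [IsFractionRing B L] [Algebra A B] [Module.Finite A B] [Module.IsTorsionFree A B]
  [Algebra K L] [Algebra A L] [IsScalarTower A K L] [IsScalarTower A B L] [Algebra.IsSeparable K L]

include K L in
/-- **Tame primes (Javanpeykar 2014, proof of Thm. 4.3.2; Prop. 4.1.3 with `m = 0`).** `A` a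
discrete valuation ring with `p ∈ 𝔪_A` (`p` prime: the residue characteristic), `B` Dedekind,
finite torsion-free over `A`, `L = Frac B` separable over `K = Frac A`, `β` maximal with
`𝔪 B = β ^ e · I`, `β + I = B`, `f = dim_κ (B ⧸ β)`. If `e f < p` ("residue characteristic strictly
bigger than `deg π`", as `e_β f_β ≤ deg π`), then `β ^ e ∤ 𝔇_{B/A}`: **`r_β ≤ e_β - 1`**, the
ramification at `β` is tame. [cite: Javanpeykar2014, proof of Thm. 4.3.2] -/
theorem not_pow_dvd_differentIdeal_of_mul_finrank_lt (β : Ideal B) [β.IsMaximal] {e : ℕ}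
    {I : Ideal B} (hfac : (maximalIdeal A).map (algebraMap A B) = β ^ e * I) (hcop : β ⊔ I = ⊤)
    [(β ^ e).LiesOver (maximalIdeal A)] [β.LiesOver (maximalIdeal A)] {p : ℕ} (hp : p.Prime)
    (hpA : (p : A) ∈ maximalIdeal A)
    (hlt : e * Module.finrank (A ⧸ maximalIdeal A) (B ⧸ β) < p) :
    ¬ β ^ e ∣ differentIdeal A B := by
  have h := not_pow_dvd_differentIdeal_of_prime_pow_notMem A K L B β hfac hcop (m := 0) (k := 1)
    hp hpA (by rwa [zero_add, pow_one]) (by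
      rw [pow_zero, pow_one]
      exact (Ideal.ne_top_iff_one _).mp (maximalIdeal.isMaximal A).ne_top)
  rwa [mul_one] at h

include K L in
/-- The universal lower bound in the same setting: **`β ^ (e - 1) ∣ 𝔇_{B/A}`** whenever
`𝔪 B = β ^ e · I` (Mathlib's `pow_sub_one_dvd_differentIdeal`, with separability transported from
`K ⊆ L` to the fraction rings). Together with the previous theorem: in the tame case
**`ord_β(𝔇_{B/A}) = e_β - 1`** ("the valuation of the different ideal … is precisely the
multiplicity of `D` in `𝒴_𝔭`" minus one). [cite: Javanpeykar2014, proof of Thm. 4.3.2] -/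
theorem pow_sub_one_dvd_differentIdeal_of_map_eq (β : Ideal B) {e : ℕ} {I : Ideal B}
    (hfac : (maximalIdeal A).map (algebraMap A B) = β ^ e * I) :
    β ^ (e - 1) ∣ differentIdeal A B := by
  letI := FractionRing.liftAlgebra A (FractionRing B)
  haveI : Algebra.IsSeparable (FractionRing A) (FractionRing B) :=
    isSeparable_fractionRing_of_isSeparable A K L B
  refine pow_sub_one_dvd_differentIdeal A β e ?_ ⟨I, hfac⟩
  exact (IsDiscreteValuationRing.not_a_field A)

include K L in
/-- **Reduced fibre in large characteristic ⇒ unramified (Javanpeykar 2014, proof of Thm. 4.3.2).**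
If `𝔪 B = β · I` with `β + I = B` (`e_β = 1`: "the fibres of `𝒴` over `O_L` are reduced") and
`f = dim_κ (B ⧸ β) < p` (residue characteristic bigger than the degree), then `β ∤ 𝔇_{B/A}`
("we see that the finite morphism `π` is unramified over `𝔭`"). [cite: Javanpeykar2014, proof of
Thm. 4.3.2] -/
theorem not_dvd_differentIdeal_of_finrank_lt (β : Ideal B) [β.IsMaximal] {I : Ideal B}
    (hfac : (maximalIdeal A).map (algebraMap A B) = β * I) (hcop : β ⊔ I = ⊤)
    [β.LiesOver (maximalIdeal A)] {p : ℕ} (hp : p.Prime) (hpA : (p : A) ∈ maximalIdeal A)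
    (hlt : Module.finrank (A ⧸ maximalIdeal A) (B ⧸ β) < p) :
    ¬ β ∣ differentIdeal A B := by
  haveI : (β ^ 1).LiesOver (maximalIdeal A) := by rwa [pow_one]
  have h := not_pow_dvd_differentIdeal_of_mul_finrank_lt A K L B β (e := 1) (I := I)
    (by rwa [pow_one]) hcop hp hpA (by rwa [one_mul])
  rwa [pow_one] at h

include K L in
/-- The same conclusion in Mathlib's language: under the hypotheses of
`not_dvd_differentIdeal_of_finrank_lt`, **`B` is unramified at `β`** (`Algebra.IsUnramifiedAt`),
by Mathlib's `not_dvd_differentIdeal_iff`. [cite: Javanpeykar2014, proof of Thm. 4.3.2] -/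
theorem isUnramifiedAt_of_finrank_lt (β : Ideal B) [β.IsMaximal] {I : Ideal B}
    (hfac : (maximalIdeal A).map (algebraMap A B) = β * I) (hcop : β ⊔ I = ⊤)
    [β.LiesOver (maximalIdeal A)] {p : ℕ} (hp : p.Prime) (hpA : (p : A) ∈ maximalIdeal A)
    (hlt : Module.finrank (A ⧸ maximalIdeal A) (B ⧸ β) < p) :
    Algebra.IsUnramifiedAt A β := by
  letI := FractionRing.liftAlgebra A (FractionRing B)
  haveI : Algebra.IsSeparable (FractionRing A) (FractionRing B) :=
    isSeparable_fractionRing_of_isSeparable A K L B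
  exact not_dvd_differentIdeal_iff.mp (not_dvd_differentIdeal_of_finrank_lt A K L B β hfac hcop
    hp hpA hlt)

include K L in
/-- **Tame primes in residue characteristic `0` (the horizontal divisors of Prop. 4.2.4).** If the
residue field `κ = A ⧸ 𝔪` has characteristic `0`, then `β ^ e ∤ 𝔇_{B/A}` for every maximal `β`
with `𝔪 B = β^e · I`, `β + I = B` (`e ≥ 1`): together with `β^{e-1} ∣ 𝔇_{B/A}` this is
**`r_β = e_β - 1`** ("for all `i` in `I₁` and `j` in `J_i`, the ramification of `D_ij` over `D_i`
is tame, i.e., the equality `r_ij = e_ij - 1` holds" — for the horizontal `D_i`, whose local rings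
have residue characteristic `p_i = 0`; the vertical `D_i` with `p_i > deg π` are
`not_pow_dvd_differentIdeal_of_mul_finrank_lt`). From the `e f`-form of Prop. 4.1.3
(`HenselDifferentBound`): `e f ≠ 0` in `κ`. [cite: Javanpeykar2014, Prop. 4.2.4 (proof)] -/
theorem not_pow_dvd_differentIdeal_of_charZero_residueField (β : Ideal B) [β.IsMaximal] {e : ℕ}
    (he : e ≠ 0) {I : Ideal B} (hfac : (maximalIdeal A).map (algebraMap A B) = β ^ e * I)
    (hcop : β ⊔ I = ⊤) [(β ^ e).LiesOver (maximalIdeal A)] [β.LiesOver (maximalIdeal A)]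
    [CharZero (A ⧸ maximalIdeal A)] : ¬ β ^ e ∣ differentIdeal A B := by
  have h := not_pow_dvd_differentIdeal_of_natCast_mul_finrank_notMem A K L B β hfac hcop
    (k := 1) ?_
  · rwa [mul_one] at h
  rw [pow_one, ← Ideal.Quotient.eq_zero_iff_mem, map_natCast, Nat.cast_eq_zero]
  -- `e f ≠ 0`
  letI := Ideal.Quotient.field (maximalIdeal A)
  haveI : Module.Finite (A ⧸ maximalIdeal A) (B ⧸ β) :=
    Module.Finite.of_restrictScalars_finite A _ _
  haveI : Nontrivial (B ⧸ β) := Ideal.Quotient.nontrivial_iff.2 (Ideal.IsMaximal.ne_top ‹_›)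
  exact mul_ne_zero he Module.finrank_pos.ne'

end Tame

end Literature.NumberTheory.NumberFields
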